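import Mathlib.Algebra.Category.ModuleCat.Injective
import Mathlib.Algebra.Module.Injective
import Mathlib.Algebra.Module.LocalizedModule.Basic
import Mathlib.RingTheory.Flat.Basic
import Mathlib.RingTheory.Flat.Stability
import Mathlib.RingTheory.Flat.Localization
import Mathlib.RingTheory.Localization.FractionRing
import Mathlib.LinearAlgebra.Basis.VectorSpace
import Mathlib.Algebra.Homology.DerivedCategory.Ext.EnoughInjectives
import Mathlib.Algebra.Homology.DerivedCategory.Ext.ExactSequences
import Mathlib.Algebra.Category.ModuleCat.Ext.HasExt
import HarnessLib

/-!
# Crux `NoZenoR` (stmt-ResolutionOfSingularities-19943), W3 print `jacobianFloorNN_normal_dim3` —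
# homological lemmas: torsion-free modules against two-term resolutions

Route `ResolutionOfSingularities/HomologicalConductor` (cell decomp-res, hand leafhand-res-homologicalconduct-16 g1).
OURS: AI-written support lemmas, weaker than expert review; nothing here is a statement of the manuscript
under review (Hironaka 2017), and nothing here is a NAMED FACT.  SUPPORT level, counted 0.  Def-free.

Elementary homological algebra used to prove the noether-different floor `𝔑(B/A) ⊆ caᵈ⁺¹(B)` of
[IyengarTakahashi2016, Thm 3.8] for torsion-free algebras of projective dimension `≤ 1` WITHOUT the
derived noether different (sibling file `HomologicalConductorNoZenoRNoetherDifferentTorsionFree.lean`),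
whence the W3 print `Literature.RingTheory.CohomologyAnnihilator.jacobianFloorNN_normal_dim3` of the
registered stub `stub_publishedSurfaceFactsW3`.  All statements folklore; proofs ours.

* `injective_linearMap_of_flat` — `Hom_A(P, I)` is an injective module for `P` flat and `I` injective
  (`Hom(X, Hom(P, I)) = Hom(X ⊗ P, I)`, `− ⊗ P` preserves monomorphisms);
* `lTensor_injective_of_noZeroSMulDivisors` — over a domain `A`, for `X` torsion-free and an injective
  `ι : P₁ → P₀` with `P₁` flat, `X ⊗ ι` is injective (`Tor₁^A(X, P₀/P₁) = 0`): `X` embeds in its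
  localisation at `A ∖ 0`, a vector space over `Frac A`, which is FLAT over `A`;
* `ext_eq_zero_of_shortExact_of_injective`, `ext_one_eq_zero_of_shortExact_of_lift` — if
  `0 → H → E₀ → E₁ → 0` is exact with `E₀, E₁` injective then `Ext^{≥2}(X, H) = 0`, and `Ext¹(X, H) = 0`
  as soon as maps `X → E₁` lift to `E₀`.

## References

* S. B. Iyengar, R. Takahashi, *The Jacobian ideal of a commutative ring and annihilators of
  cohomology*, J. Algebra 2021; arXiv:1610.02599 — Lemma 3.7, Thm 3.8. [`IyengarTakahashi2016`]
-/

noncomputable section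

-- single-problem summit: the doubled namespace component `ResolutionOfSingularities` is forced
set_option linter.dupNamespace false

open CategoryTheory CategoryTheory.Abelian
open scoped TensorProduct

universe u

namespace Summit.ResolutionOfSingularities.ResolutionOfSingularities.Theorems.NoZeno.TorsionFreeTwoTerm

/-! ## §1 `Hom_A(P, I)` is injective for `P` flat and `I` injective -/

section HomInjective

variable {A : Type u} [CommRing A]

/-- For a flat module `P` and an injective module `I`, the module `Hom_A(P, I)` is injective
(`Hom(X, Hom(P, I)) = Hom(X ⊗ P, I)` and `- ⊗ P` preserves monomorphisms). [folklore] -/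
theorem injective_linearMap_of_flat (P I : Type u) [AddCommGroup P] [Module A P] [Module.Flat A P]
    [AddCommGroup I] [Module A I] [Module.Injective A I] : Module.Injective A (P →ₗ[A] I) := by
  refine ⟨fun X Y _ _ _ _ f hf g => ?_⟩
  -- uncurry `g` to `X ⊗ P → I`, extend along the mono `X ⊗ P → Y ⊗ P`, curry back
  obtain ⟨h, hh⟩ := Module.Injective.extension_property A I _ _ (f.rTensor P)
    (Module.Flat.rTensor_preserves_injective_linearMap f hf) (TensorProduct.lift g)
  refine ⟨TensorProduct.curry h, fun x => ?_⟩
  ext p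
  have := LinearMap.congr_fun hh (x ⊗ₜ p)
  simpa using this

end HomInjective

/-! ## §2 Torsion-free modules are `Tor₁`-independent of modules of projective dimension `≤ 1` -/

section TorsionFree

variable {A : Type u} [CommRing A] [IsDomain A]

/-- Over a domain `A`: if `X` is torsion-free and `ι : P₁ → P₀` is an injective linear map out of a
FLAT module `P₁`, then `X ⊗ ι : X ⊗ P₁ → X ⊗ P₀` is injective (i.e. `Tor₁^A(X, P₀/P₁) = 0`): embed
`X` in its localisation `X_K` at `A ∖ 0`, a vector space over `K = Frac A`, hence FLAT over `A`.
[folklore] -/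
theorem lTensor_injective_of_noZeroSMulDivisors (X : Type u) [AddCommGroup X] [Module A X]
    [NoZeroSMulDivisors A X] {P₁ P₀ : Type u} [AddCommGroup P₁] [Module A P₁] [Module.Flat A P₁]
    [AddCommGroup P₀] [Module A P₀] (ι : P₁ →ₗ[A] P₀) (hι : Function.Injective ι) :
    Function.Injective (ι.lTensor X) := by
  -- the localisation `X_K`, a `K`-vector space, flat over `A`
  let K := FractionRing A
  let XK := LocalizedModule (nonZeroDivisors A) X
  haveI : Module.Flat A K := IsLocalization.flat K (nonZeroDivisors A)
  haveI : Module.Flat K XK := inferInstance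
  haveI : Module.Flat A XK := Module.Flat.trans A K XK
  -- `X → X_K` is injective since `X` is torsion-free
  let j : X →ₗ[A] XK := LocalizedModule.mkLinearMap (nonZeroDivisors A) X
  have hj : Function.Injective j := by
    rw [injective_iff_map_eq_zero]
    intro x hx
    obtain ⟨s, hs⟩ := (IsLocalizedModule.eq_zero_iff (nonZeroDivisors A) j).mp hx
    exact (smul_eq_zero.mp hs).resolve_left (nonZeroDivisors.ne_zero s.2)
  -- `X ⊗ P₁ → X_K ⊗ P₁ → X_K ⊗ P₀` is injective and factors through `X ⊗ ι`
  have h1 : Function.Injective (j.rTensor P₁) :=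
    Module.Flat.rTensor_preserves_injective_linearMap j hj
  have h2 : Function.Injective (ι.lTensor XK) :=
    Module.Flat.lTensor_preserves_injective_linearMap ι hι
  have hcomp : (ι.lTensor XK) ∘ₗ (j.rTensor P₁) = (j.rTensor P₀) ∘ₗ (ι.lTensor X) := by
    rw [LinearMap.lTensor_comp_rTensor, LinearMap.rTensor_comp_lTensor]
  have h12 : Function.Injective ((j.rTensor P₀) ∘ₗ (ι.lTensor X)) := by
    rw [← hcomp]; exact h2.comp h1
  exact Function.Injective.of_comp h12

end TorsionFree

/-! ## §3 Two-term injective resolutions: `Ext` into the middle term -/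

section TwoTerm

variable {A : Type u} [CommRing A]

/-- If `0 → H → E₀ → E₁ → 0` is short exact with `E₀`, `E₁` injective (`injdim H ≤ 1`), then
`Extʲ(X, H) = 0` for all `X` and `j ≥ 2`. [folklore] -/
theorem ext_eq_zero_of_shortExact_of_injective {T : ShortComplex (ModuleCat.{u} A)}
    (hT : T.ShortExact) [Injective T.X₂] [Injective T.X₃] (X : ModuleCat.{u} A) (j : ℕ)
    (e : Ext.{u} X T.X₁ (j + 2)) : e = 0 := by
  have h1 : e.comp (Ext.mk₀ T.f) (add_zero _) = 0 := Ext.eq_zero_of_injective _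
  obtain ⟨x₃, rfl⟩ := Ext.covariant_sequence_exact₁ X hT e h1 (n₀ := j + 1) (by omega)
  rw [(Ext.eq_zero_of_injective x₃ : x₃ = 0), Ext.zero_comp]

/-- If `0 → H → E₀ → E₁ → 0` is short exact with `E₀` injective and every map `X → E₁` lifts to
`E₀`, then `Ext¹(X, H) = 0`. [folklore] -/
theorem ext_one_eq_zero_of_shortExact_of_lift {T : ShortComplex (ModuleCat.{u} A)}
    (hT : T.ShortExact) [Injective T.X₂] (X : ModuleCat.{u} A)
    (hlift : ∀ φ : X ⟶ T.X₃, ∃ ψ : X ⟶ T.X₂, ψ ≫ T.g = φ) (e : Ext.{u} X T.X₁ 1) : e = 0 := by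
  have h1 : e.comp (Ext.mk₀ T.f) (add_zero _) = 0 := Ext.eq_zero_of_injective _
  obtain ⟨x₃, rfl⟩ := Ext.covariant_sequence_exact₁ X hT e h1 (n₀ := 0) (zero_add 1)
  obtain ⟨φ, rfl⟩ := (Ext.mk₀_bijective _ _).2 x₃
  obtain ⟨ψ, rfl⟩ := hlift φ
  rw [← Ext.mk₀_comp_mk₀, Ext.comp_assoc_of_second_deg_zero, hT.comp_extClass, Ext.comp_zero]

end TwoTerm

end Summit.ResolutionOfSingularities.ResolutionOfSingularities.Theorems.NoZeno.TorsionFreeTwoTerm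

end
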